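import Mathlib.Analysis.Calculus.ContDiff.Bounds
import Mathlib.Analysis.InnerProductSpace.Calculus
import Literature.Analysis.FluidPDE.CompressibleEulerProfileSharpDecay
import HarnessLib

/-!
# Sharp far-field asymptotics of the profile FIELDS on `ℝ³`: `|∇ⁿS̄(y)|, |∇ⁿŪ(y)| ≲ |y|^{1−r−n}`
# (theorems only)

Topic `Literature/Analysis/FluidPDE`; namespace `Literature.Analysis.FluidPDE.CaolaboraEtAl2025`.
Sequel of `CompressibleEulerProfileSharpDecay.lean` (radial form: `|U^{(k)}(ζ)|, |S^{(k)}(ζ)| ≤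
C ζ^{1−r−k}`, and through `s = ζ²`: `|dᵏ/dsᵏ S(√s)| ≤ C s^{(1−r)/2−k}`,
`|dᵏ/dsᵏ U(√s)/√s| ≤ C s^{−r/2−k}`). THEOREMS ONLY, no new facts (D-0026).

This file proves eq. (1.6) of Cao-Labora–Gómez-Serrano–Shi–Staffilani (p. 6 of the held text
`paper-arxiv-2310.05325`) for the profile fields on `ℝ³` exactly as printed,
`|∇ʲŪ| + |∇ʲS̄| ≲ ⟨ζ⟩^{1−r−j}` far from the origin, for profiles as in the vendored fact
`BuckmasterCaolaboraGomezserrano2025_thm11_monatomic` with `1 < r < 2`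
(`norm_iteratedFDeriv_radialScalar_sharp`, `norm_iteratedFDeriv_radialField_sharp`). The
fields factor through `q(y) = |y|²`: `S̄ = g ∘ q`, `Ū = (h ∘ q) · id` with `g(s) = S(√s)`,
`h(s) = U(√s)/√s`; the passage from one-variable bounds `|g^{(j)}(s)| ≤ C s^{c−j}` to
`‖∇ⁿ(g ∘ q)(y)‖ ≤ C |y|^{2c−n}` is an induction on `n` using `∇(g∘q) = (g′∘q) · 2⟨y, ·⟩`,
the Leibniz bound for iterated derivatives of a product (Mathlib
`norm_iteratedFDerivWithin_smul_le`) and the fact that the linear factor has `∇⁰ = O(|y|)`,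
`∇¹ = O(1)`, `∇^{≥2} = 0` (`norm_iteratedFDeriv_clm_le`); in each Leibniz term the exponents add
up to the same total `2c − n` (`leibniz_sum_le`), which is why no loss occurs
(`exists_bound_iteratedFDerivWithin_comp_norm_sq`).
[cite: CaolaboraEtAl2025, eq. (1.6) p. 6] [cite: BuckmasterCaolaboraGomezserrano2025, Thm 1.1 p. 4]
-/

noncomputable section

open Set Filter Topology Metric
open scoped ContDiff

namespace Literature.Analysis.FluidPDE

open Literature.MathematicalPhysics.KineticTheory (V3)

namespace CaolaboraEtAl2025

/-! ### Linear factors and the Leibniz sum -/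

section Tools

variable {G : Type*} [NormedAddCommGroup G] [NormedSpace ℝ G]

/-- Iterated derivatives of a continuous linear map: `‖∇ᵐA(y)‖ ≤ ‖A‖ |y|^{1−m}` for `|y| ≥ 1`
(`∇⁰A = A(y)`, `∇¹A ≡ A`, `∇^{≥2}A = 0`). [folklore] -/
theorem norm_iteratedFDeriv_clm_le (A : V3 →L[ℝ] G) {y : V3} (hy : 1 ≤ ‖y‖) :
    ∀ m : ℕ, ‖iteratedFDeriv ℝ m (⇑A) y‖ ≤ ‖A‖ * ‖y‖ ^ (1 - (m : ℝ))
  | 0 => by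
    rw [norm_iteratedFDeriv_zero, Nat.cast_zero, sub_zero, Real.rpow_one]
    exact A.le_opNorm y
  | 1 => by
    rw [norm_iteratedFDeriv_one, A.fderiv, Nat.cast_one, sub_self, Real.rpow_zero, mul_one]
  | m + 2 => by
    have h0 : iteratedFDeriv ℝ (m + 2) (⇑A) y = 0 := by
      rw [iteratedFDeriv_succ_eq_comp_right]
      simp only [Function.comp_apply, ContinuousLinearMap.fderiv, iteratedFDeriv_succ_const,
        Pi.zero_apply]
      exact LinearIsometryEquiv.map_zero _
    rw [h0, norm_zero]
    have : 0 < ‖y‖ := by linarith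
    positivity

/-- The exponent bookkeeping of one Leibniz step: if `F_j ≤ a_j t^{e−j}` and
`L_m ≤ B t^{1−m}` for `j, m ≤ n` (`F, L ≥ 0`, `t > 0`), then
`∑ⱼ C(n,j) F_j L_{n−j} ≤ (∑ⱼ C(n,j) a_j B) t^{e+1−n}`. [folklore] -/
theorem leibniz_sum_le {n : ℕ} {F L a : ℕ → ℝ} {B t e : ℝ} (ht : 0 < t)
    (hF0 : ∀ j, 0 ≤ F j) (hL0 : ∀ m, 0 ≤ L m) (hF : ∀ j, j ≤ n → F j ≤ a j * t ^ (e - j))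
    (hL : ∀ m, m ≤ n → L m ≤ B * t ^ (1 - (m : ℝ))) :
    ∑ j ∈ Finset.range (n + 1), (n.choose j : ℝ) * F j * L (n - j) ≤
      (∑ j ∈ Finset.range (n + 1), (n.choose j : ℝ) * a j * B) * t ^ (e + 1 - n) := by
  rw [Finset.sum_mul]
  refine Finset.sum_le_sum fun j hj => ?_
  have hjn : j ≤ n := Nat.lt_succ_iff.1 (Finset.mem_range.1 hj)
  have h1 := hF j hjn
  have h2 := hL (n - j) (Nat.sub_le n j)
  have ha0 : 0 ≤ a j * t ^ (e - j) := (hF0 j).trans h1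
  have h3 : F j * L (n - j) ≤ (a j * t ^ (e - j)) * (B * t ^ (1 - ((n - j : ℕ) : ℝ))) :=
    mul_le_mul h1 h2 (hL0 _) ha0
  have h4 : (a j * t ^ (e - j)) * (B * t ^ (1 - ((n - j : ℕ) : ℝ))) =
      a j * B * t ^ (e + 1 - n) := by
    rw [Nat.cast_sub hjn]
    have h5 : t ^ (e - j) * t ^ (1 - ((n : ℝ) - j)) = t ^ (e + 1 - n) := by
      rw [← Real.rpow_add ht]
      ring_nf
    calc (a j * t ^ (e - j)) * (B * t ^ (1 - ((n : ℝ) - j)))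
        = a j * B * (t ^ (e - j) * t ^ (1 - ((n : ℝ) - j))) := by ring
      _ = a j * B * t ^ (e + 1 - n) := by rw [h5]
  calc (n.choose j : ℝ) * F j * L (n - j) = (n.choose j : ℝ) * (F j * L (n - j)) := by ring
    _ ≤ (n.choose j : ℝ) * ((a j * t ^ (e - j)) * (B * t ^ (1 - ((n - j : ℕ) : ℝ)))) :=
        mul_le_mul_of_nonneg_left h3 (Nat.cast_nonneg _)
    _ = (n.choose j : ℝ) * a j * B * t ^ (e + 1 - n) := by rw [h4]; ring

end Tools

/-! ### Iterated derivatives of `g(|y|²)` from one-variable bounds -/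

section Comp

/-- **Derivatives of `y ↦ g(|y|²)` from the derivatives of `g`.** If `g` is smooth on `(s₀, ∞)`,
`s₀ ≥ 1`, with `|g^{(j)}(s)| ≤ C_j s^{c−j}` there, then on `{|y|² > s₀}` all derivatives of
`y ↦ g(|y|²)` up to order `n` satisfy `‖∇ⁱ[g(|·|²)](y)‖ ≤ A_i |y|^{2c−i}` (induction on `n`:
`∇(g∘q) = (g′∘q)·2⟨y,·⟩`, Leibniz, and the linear factor has `∇⁰ = O(|y|)`, `∇¹ = O(1)`,
`∇^{≥2} = 0`). [folklore] -/
theorem exists_bound_iteratedFDerivWithin_comp_norm_sq {s₀ : ℝ} (hs₀ : 1 ≤ s₀) :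
    ∀ (n : ℕ) {g : ℝ → ℝ} {c : ℝ}, ContDiffOn ℝ ∞ g (Ioi s₀) →
      (∀ j : ℕ, ∃ C, ∀ s, s₀ < s → |iteratedDeriv j g s| ≤ C * s ^ (c - j)) →
      ∃ A : ℕ → ℝ, ∀ i, i ≤ n → ∀ y : V3, s₀ < ‖y‖ ^ 2 →
        ‖iteratedFDerivWithin ℝ i (fun y : V3 => g (‖y‖ ^ 2)) {y : V3 | s₀ < ‖y‖ ^ 2} y‖ ≤
          A i * ‖y‖ ^ (2 * c - i) := by
  -- the open set and generalities
  have hΩo : IsOpen {y : V3 | s₀ < ‖y‖ ^ 2} := isOpen_lt continuous_const (continuous_norm.pow 2)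
  have hΩu : UniqueDiffOn ℝ {y : V3 | s₀ < ‖y‖ ^ 2} := hΩo.uniqueDiffOn
  have hypos : ∀ y : V3, s₀ < ‖y‖ ^ 2 → 1 ≤ ‖y‖ := fun y hy => by
    by_contra h
    push Not at h
    have : ‖y‖ ^ 2 < 1 := by nlinarith [norm_nonneg y]
    linarith
  intro n
  induction n with
  | zero =>
    intro g c hg hb
    obtain ⟨C₀, hC₀⟩ := hb 0
    refine ⟨fun _ => C₀, fun i hi y hy => ?_⟩
    obtain rfl : i = 0 := Nat.le_zero.1 hi
    have hy0 : 0 < ‖y‖ := by linarith [hypos y hy]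
    rw [norm_iteratedFDerivWithin_zero, Real.norm_eq_abs, Nat.cast_zero, sub_zero]
    have h := hC₀ (‖y‖ ^ 2) hy
    rw [iteratedDeriv_zero, Nat.cast_zero, sub_zero] at h
    rwa [Real.rpow_mul (norm_nonneg y), Real.rpow_two]
  | succ n ih =>
    intro g c hg hb
    -- bounds up to order `n` for `g`, and for `g′` with exponent `c - 1`
    obtain ⟨A, hA⟩ := ih hg hb
    have hg' : ContDiffOn ℝ ∞ (deriv g) (Ioi s₀) :=
      hg.deriv_of_isOpen isOpen_Ioi (by exact (rfl : (∞ : ℕ∞ω) + 1 = ∞).le)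
    have hb' : ∀ j : ℕ, ∃ C, ∀ s, s₀ < s → |iteratedDeriv j (deriv g) s| ≤ C * s ^ (c - 1 - j) := by
      intro j
      obtain ⟨C, hC⟩ := hb (j + 1)
      refine ⟨C, fun s hs => ?_⟩
      rw [← iteratedDeriv_succ', show c - 1 - (j : ℝ) = c - ((j + 1 : ℕ) : ℝ) by push_cast; ring]
      exact hC s hs
    obtain ⟨A', hA'⟩ := ih hg' hb'
    -- the linear factor
    set Lc : V3 →L[ℝ] V3 →L[ℝ] ℝ := (2 : ℝ) • innerSL ℝ (E := V3) with hLc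
    set B : ℝ := ‖Lc‖ with hB
    refine ⟨fun i => if i ≤ n then A i else
      ∑ j ∈ Finset.range (n + 1), (n.choose j : ℝ) * A' j * B, fun i hi y hy => ?_⟩
    by_cases hin : i ≤ n
    · dsimp only
      rw [if_pos hin]
      exact hA i hin y hy
    · obtain rfl : i = n + 1 := le_antisymm hi (Nat.lt_of_not_le hin)
      dsimp only
      rw [if_neg hin]
      have hy1 : 1 ≤ ‖y‖ := hypos y hy
      have hy0 : 0 < ‖y‖ := by linarith
      -- `∇(g ∘ q) = (g′ ∘ q) • Lc` on the open set
      have hderiv : EqOn (fderivWithin ℝ (fun y : V3 => g (‖y‖ ^ 2)) {y : V3 | s₀ < ‖y‖ ^ 2})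
          (fun y : V3 => deriv g (‖y‖ ^ 2) • Lc y) {y : V3 | s₀ < ‖y‖ ^ 2} := by
        intro z hz
        have hgz : HasDerivAt g (deriv g (‖z‖ ^ 2)) (‖z‖ ^ 2) :=
          ((hg.contDiffAt (Ioi_mem_nhds hz)).differentiableAt (by simp)).hasDerivAt
        have hq : HasFDerivAt (fun z : V3 => ‖z‖ ^ 2) (Lc z) z := by
          have h := (hasStrictFDerivAt_norm_sq z).hasFDerivAt
          have e : Lc z = (2 : ℕ) • innerSL ℝ z := by
            rw [hLc, smul_apply, ← Nat.cast_smul_eq_nsmul ℝ]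
            norm_num
          rw [e]
          exact h
        have h := hgz.comp_hasFDerivAt z hq
        rw [fderivWithin_of_isOpen hΩo hz]
        exact h.fderiv
      -- regularity on the open set
      have hG' : ContDiffOn ℝ ∞ (fun y : V3 => deriv g (‖y‖ ^ 2)) {y : V3 | s₀ < ‖y‖ ^ 2} :=
        fun z hz => ((hg'.contDiffAt (Ioi_mem_nhds hz)).comp z
          (contDiff_norm_sq ℝ).contDiffAt).contDiffWithinAt
      have hL : ContDiffOn ℝ ∞ (fun y : V3 => Lc y) {y : V3 | s₀ < ‖y‖ ^ 2} :=
        Lc.contDiff.contDiffOn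
      -- the Leibniz estimate
      rw [← norm_iteratedFDerivWithin_fderivWithin hΩu hy,
        iteratedFDerivWithin_congr hderiv hy]
      have hleib := norm_iteratedFDerivWithin_smul_le (𝕜 := ℝ) hG' hL hΩu hy
        (n := n) (by exact_mod_cast le_top)
      refine hleib.trans ?_
      have hLb : ∀ m, m ≤ n → ‖iteratedFDerivWithin ℝ m (fun y : V3 => Lc y)
          {y : V3 | s₀ < ‖y‖ ^ 2} y‖ ≤ B * ‖y‖ ^ (1 - (m : ℝ)) := by
        intro m _
        rw [iteratedFDerivWithin_of_isOpen m hΩo hy]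
        exact norm_iteratedFDeriv_clm_le Lc hy1 m
      have key := leibniz_sum_le (n := n) (e := 2 * (c - 1))
        (F := fun j => ‖iteratedFDerivWithin ℝ j (fun y : V3 => deriv g (‖y‖ ^ 2))
          {y : V3 | s₀ < ‖y‖ ^ 2} y‖)
        (L := fun m => ‖iteratedFDerivWithin ℝ m (fun y : V3 => Lc y) {y : V3 | s₀ < ‖y‖ ^ 2} y‖)
        (a := A') (B := B) hy0 (fun j => norm_nonneg _) (fun m => norm_nonneg _)
        (fun j hj => by simpa [mul_sub] using hA' j hj y hy) hLb
      refine key.trans (le_of_eq ?_)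
      congr 1
      push_cast
      ring_nf

end Comp

/-! ### The fields -/

section Fields

variable {r : ℝ} {U S : ℝ → ℝ}

/-- **Eq. (1.6) for `S̄`:** for profiles as in the vendored fact with `1 < r < 2` and every `n`
there are `R > 0`, `C` with `‖∇ⁿ[S(|·|)](y)‖ ≤ C |y|^{1−r−n}` for `|y| ≥ R`.
[cite: CaolaboraEtAl2025, eq. (1.6) p. 6] -/
theorem norm_iteratedFDeriv_radialScalar_sharp (hr1 : 1 < r) (hr2 : r < 2)
    (hU : ContDiff ℝ ∞ fun y : V3 => (U ‖y‖ / ‖y‖) • y) (hS : ContDiff ℝ ∞ fun y : V3 => S ‖y‖)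
    (hode : ∀ ζ : ℝ, 0 < ζ →
      (r - 1) * U ζ + (ζ + U ζ) * deriv U ζ + 1 / 3 * S ζ * deriv S ζ = 0 ∧
      (r - 1) * S ζ + (ζ + U ζ) * deriv S ζ + 1 / 3 * S ζ * (deriv U ζ + 2 * U ζ / ζ) = 0)
    (hlimU : Tendsto (fun ζ => U ζ / ζ) atTop (𝓝 0))
    (hlimS : Tendsto (fun ζ => S ζ / ζ) atTop (𝓝 0)) (n : ℕ) :
    ∃ R C : ℝ, 0 < R ∧ ∀ y : V3, R ≤ ‖y‖ →
      ‖iteratedFDeriv ℝ n (fun y : V3 => S ‖y‖) y‖ ≤ C * ‖y‖ ^ (1 - r - n) := by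
  obtain ⟨s₀, hs₀1, hSq, -, hSb, -⟩ := iteratedDeriv_profile_sqrt_sharp hr1 hr2 hU hS hode hlimU hlimS
  have hg : ContDiffOn ℝ ∞ (fun s => S (Real.sqrt s)) (Ioi s₀) := fun s hs => (hSq s hs).contDiffWithinAt
  obtain ⟨A, hA⟩ := exists_bound_iteratedFDerivWithin_comp_norm_sq hs₀1 n hg hSb
  have hΩo : IsOpen {y : V3 | s₀ < ‖y‖ ^ 2} := isOpen_lt continuous_const (continuous_norm.pow 2)
  refine ⟨Real.sqrt s₀ + 1, A n, by positivity, fun y hy => ?_⟩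
  have hy2 : s₀ < ‖y‖ ^ 2 := by
    have h1 : Real.sqrt s₀ < ‖y‖ := by linarith
    calc s₀ = Real.sqrt s₀ ^ 2 := (Real.sq_sqrt (by linarith)).symm
      _ < ‖y‖ ^ 2 := by gcongr
  have hfun : (fun y : V3 => S ‖y‖) = fun y : V3 => S (Real.sqrt (‖y‖ ^ 2)) := by
    funext z
    rw [Real.sqrt_sq (norm_nonneg z)]
  rw [hfun, ← iteratedFDerivWithin_of_isOpen n hΩo hy2]
  have h := hA n le_rfl y hy2
  convert h using 2
  ring

/-- **Eq. (1.6) for `Ū`:** for profiles as in the vendored fact with `1 < r < 2` and every `n`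
there are `R > 0`, `C` with `‖∇ⁿ[U(|·|) ·/|·|](y)‖ ≤ C |y|^{1−r−n}` for `|y| ≥ R`.
[cite: CaolaboraEtAl2025, eq. (1.6) p. 6] -/
theorem norm_iteratedFDeriv_radialField_sharp (hr1 : 1 < r) (hr2 : r < 2)
    (hU : ContDiff ℝ ∞ fun y : V3 => (U ‖y‖ / ‖y‖) • y) (hS : ContDiff ℝ ∞ fun y : V3 => S ‖y‖)
    (hode : ∀ ζ : ℝ, 0 < ζ →
      (r - 1) * U ζ + (ζ + U ζ) * deriv U ζ + 1 / 3 * S ζ * deriv S ζ = 0 ∧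
      (r - 1) * S ζ + (ζ + U ζ) * deriv S ζ + 1 / 3 * S ζ * (deriv U ζ + 2 * U ζ / ζ) = 0)
    (hlimU : Tendsto (fun ζ => U ζ / ζ) atTop (𝓝 0))
    (hlimS : Tendsto (fun ζ => S ζ / ζ) atTop (𝓝 0)) (n : ℕ) :
    ∃ R C : ℝ, 0 < R ∧ ∀ y : V3, R ≤ ‖y‖ →
      ‖iteratedFDeriv ℝ n (fun y : V3 => (U ‖y‖ / ‖y‖) • y) y‖ ≤ C * ‖y‖ ^ (1 - r - n) := by
  obtain ⟨s₀, hs₀1, -, hUq, -, hUb⟩ := iteratedDeriv_profile_sqrt_sharp hr1 hr2 hU hS hode hlimU hlimS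
  have hg : ContDiffOn ℝ ∞ (fun s => U (Real.sqrt s) / Real.sqrt s) (Ioi s₀) :=
    fun s hs => (hUq s hs).contDiffWithinAt
  have hUb' : ∀ j : ℕ, ∃ C, ∀ s, s₀ < s →
      |iteratedDeriv j (fun s => U (Real.sqrt s) / Real.sqrt s) s| ≤ C * s ^ (-r / 2 - j) := hUb
  obtain ⟨A, hA⟩ := exists_bound_iteratedFDerivWithin_comp_norm_sq hs₀1 n hg hUb'
  have hΩo : IsOpen {y : V3 | s₀ < ‖y‖ ^ 2} := isOpen_lt continuous_const (continuous_norm.pow 2)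
  have hΩu : UniqueDiffOn ℝ {y : V3 | s₀ < ‖y‖ ^ 2} := hΩo.uniqueDiffOn
  set B : ℝ := ‖ContinuousLinearMap.id ℝ V3‖ with hB
  refine ⟨Real.sqrt s₀ + 1, ∑ j ∈ Finset.range (n + 1), (n.choose j : ℝ) * A j * B, by positivity,
    fun y hy => ?_⟩
  have hy1 : 1 ≤ ‖y‖ := by
    have := Real.sqrt_nonneg s₀
    linarith
  have hy0 : 0 < ‖y‖ := by linarith
  have hy2 : s₀ < ‖y‖ ^ 2 := by
    have h1 : Real.sqrt s₀ < ‖y‖ := by linarith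
    calc s₀ = Real.sqrt s₀ ^ 2 := (Real.sq_sqrt (by linarith)).symm
      _ < ‖y‖ ^ 2 := by gcongr
  -- `Ū = (h ∘ q) • id` globally
  have hfun : (fun y : V3 => (U ‖y‖ / ‖y‖) • y) =
      fun y : V3 => (U (Real.sqrt (‖y‖ ^ 2)) / Real.sqrt (‖y‖ ^ 2)) • (ContinuousLinearMap.id ℝ V3) y := by
    funext z
    rw [Real.sqrt_sq (norm_nonneg z), ContinuousLinearMap.id_apply]
  rw [hfun, ← iteratedFDerivWithin_of_isOpen n hΩo hy2]
  have hG : ContDiffOn ℝ ∞ (fun y : V3 => U (Real.sqrt (‖y‖ ^ 2)) / Real.sqrt (‖y‖ ^ 2))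
      {y : V3 | s₀ < ‖y‖ ^ 2} :=
    fun z hz => ((hg.contDiffAt (Ioi_mem_nhds hz)).comp z (contDiff_norm_sq ℝ).contDiffAt).contDiffWithinAt
  have hL : ContDiffOn ℝ ∞ (fun y : V3 => (ContinuousLinearMap.id ℝ V3) y) {y : V3 | s₀ < ‖y‖ ^ 2} :=
    (ContinuousLinearMap.id ℝ V3).contDiff.contDiffOn
  have hleib := norm_iteratedFDerivWithin_smul_le (𝕜 := ℝ) hG hL hΩu hy2 (n := n)
    (by exact_mod_cast le_top)
  refine hleib.trans ?_
  have hLb : ∀ m, m ≤ n → ‖iteratedFDerivWithin ℝ m (fun y : V3 => (ContinuousLinearMap.id ℝ V3) y)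
      {y : V3 | s₀ < ‖y‖ ^ 2} y‖ ≤ B * ‖y‖ ^ (1 - (m : ℝ)) := by
    intro m _
    rw [iteratedFDerivWithin_of_isOpen m hΩo hy2]
    exact norm_iteratedFDeriv_clm_le (ContinuousLinearMap.id ℝ V3) hy1 m
  have key := leibniz_sum_le (n := n) (e := 2 * (-r / 2))
    (F := fun j => ‖iteratedFDerivWithin ℝ j
      (fun y : V3 => U (Real.sqrt (‖y‖ ^ 2)) / Real.sqrt (‖y‖ ^ 2)) {y : V3 | s₀ < ‖y‖ ^ 2} y‖)
    (L := fun m => ‖iteratedFDerivWithin ℝ m (fun y : V3 => (ContinuousLinearMap.id ℝ V3) y)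
      {y : V3 | s₀ < ‖y‖ ^ 2} y‖)
    (a := A) (B := B) hy0 (fun j => norm_nonneg _) (fun m => norm_nonneg _)
    (fun j hj => by simpa [mul_div_cancel₀] using hA j hj y hy2) hLb
  refine key.trans (le_of_eq ?_)
  congr 1
  ring_nf

end Fields

end CaolaboraEtAl2025

end Literature.Analysis.FluidPDE
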